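import Mathlib
import Summits.CriticalPhenomena.Ising3DConformalLimit.Theorems.PrecisionLaplacianEtaBoundsTransferTrig
import Summits.CriticalPhenomena.Ising3DConformalLimit.Theorems.PrecisionLaplacianEtaBoundsTransferOrtho
import HarnessLib

/-!
# Fourier transform of convolution powers and the block-sum bound via the Brillouin zone

Helper file for item `stmt-CriticalPhenomena-4804`
(`Summit.CriticalPhenomena.Ising3DConformalLimit.Theses.PrecisionLaplacian.EtaBoundsTransfer`), part of its
unconditional proof: potential theory of inverse M-matrices ⇒ infinite-volume equation and Green-function
representation; Fourier analysis on `[-π,π]^d` ⇒ block-sum upper bounds; quadratic test function ⇒ ball-sum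
lower bounds; Messager–Miracle-Solé ⇒ pointwise two-sided power bounds. No definitions are introduced: the
objects (kernel matrices, box sequences, convolution powers) enter through defining hypotheses.
-/

namespace Summit.CriticalPhenomena.Ising3DConformalLimit.Theorems.EtaBoundsTransfer

open Finset Real MeasureTheory Filter Topology Literature.Probability.LatticeModels
open scoped BigOperators

section Fourier

variable {d : ℕ} {q : Site d → ℝ} {P : ℕ → Site d → ℝ}

/-- Summability of the convolution powers' mass is inherited (`∑ P (n+1) ≤ ∑ P n`), given
nonnegativity; here we only need: each `P n` is summable implies `z ↦ q(y) P n (z - y)` families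
are summable. The sheared product family `(y, z) ↦ q y · P n (z − y)` is summable. -/
theorem summable_shear {f g : Site d → ℝ} (hf : Summable f) (hg : Summable g) (hf0 : ∀ y, 0 ≤ f y)
    (hg0 : ∀ z, 0 ≤ g z) : Summable fun p : Site d × Site d => f p.1 * g (p.2 - p.1) := by
  have h := hf.mul_of_nonneg hg (fun y => hf0 y) (fun z => hg0 z)
  set e : Site d × Site d ≃ Site d × Site d :=
    Equiv.prodShear (Equiv.refl _) (fun y => Equiv.subRight y) with he
  have : (fun p : Site d × Site d => f p.1 * g (p.2 - p.1)) = (fun p : Site d × Site d => f p.1 * g p.2) ∘ e := by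
    funext p; simp [he, Equiv.prodShear]
  rw [this]
  exact (e.summable_iff).2 h

/-- **Evenness of the convolution powers** of an even step law. -/
theorem convPow_even (hqev : ∀ y, q (-y) = q y)
    (hP0 : ∀ z, P 0 z = if z = 0 then 1 else 0)
    (hPs : ∀ n z, P (n + 1) z = ∑' y, q y * P n (z - y)) (n : ℕ) (z : Site d) :
    P n (-z) = P n z := by
  induction n generalizing z with
  | zero => simp [hP0, neg_eq_zero]
  | succ n ih =>
    rw [hPs, hPs]
    rw [← (Equiv.neg (Site d)).tsum_eq (fun y => q y * P n (-z - y))]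
    refine tsum_congr fun y => ?_
    simp only [Equiv.neg_apply, hqev]
    congr 1
    rw [show -z - -y = -(z - y) by abel, ih]

/-- An odd weighted sine sum of an even summable function vanishes:
`∑_w g(w) sin(k·w) = 0` for even `g`. -/
theorem tsum_even_mul_sin_eq_zero {g : Site d → ℝ} (hgev : ∀ w, g (-w) = g w) (k : Fin d → ℝ) :
    ∑' w, g w * Real.sin (phase d k w) = 0 := by
  have h : ∑' w, g w * Real.sin (phase d k w) = ∑' w, g (-w) * Real.sin (phase d k (-w)) :=
    ((Equiv.neg (Site d)).tsum_eq (fun w => g w * Real.sin (phase d k w))).symm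
  simp_rw [hgev, phase_neg, Real.sin_neg, mul_neg, tsum_neg] at h
  linarith

/-- **Fourier transform of the convolution powers**: `∑_z P n (z) cos(k·z) = φ(k)^n` with
`φ(k) = ∑_y q(y) cos(k·y)`, for an even nonnegative summable step law `q` and nonnegative
summable powers `P n`. -/
theorem fourier_convPow (hq0 : ∀ y, 0 ≤ q y) (hqs : Summable q) (hqev : ∀ y, q (-y) = q y)
    (hP0 : ∀ z, P 0 z = if z = 0 then 1 else 0)
    (hPs : ∀ n z, P (n + 1) z = ∑' y, q y * P n (z - y))
    (hPnn : ∀ n z, 0 ≤ P n z) (hPsum : ∀ n, Summable (P n)) (k : Fin d → ℝ) (n : ℕ) :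
    ∑' z, P n z * Real.cos (phase d k z) = (∑' y, q y * Real.cos (phase d k y)) ^ n := by
  induction n with
  | zero =>
    simp only [hP0, pow_zero, ite_mul, one_mul, zero_mul]
    rw [tsum_ite_eq]
    simp [phase]
  | succ n ih =>
    -- summability of the sheared double family with the bounded cosine factor
    have hF : Summable (Function.uncurry fun y z => q y * P n (z - y) * Real.cos (phase d k z)) := by
      have h0 : Summable fun p : Site d × Site d => q p.1 * P n (p.2 - p.1) * Real.cos (phase d k p.2) := by
        refine Summable.of_norm_bounded (summable_shear hqs (hPsum n) hq0 (hPnn n)) fun p => ?_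
        rw [Real.norm_eq_abs, abs_mul, abs_of_nonneg (mul_nonneg (hq0 _) (hPnn n _))]
        exact mul_le_of_le_one_right (mul_nonneg (hq0 _) (hPnn n _)) (Real.abs_cos_le_one _)
      exact h0.congr (fun ⟨y, z⟩ => rfl)
    calc ∑' z, P (n + 1) z * Real.cos (phase d k z)
        = ∑' z, ∑' y, q y * P n (z - y) * Real.cos (phase d k z) := by
          refine tsum_congr fun z => ?_
          rw [hPs, ← tsum_mul_right]
      _ = ∑' y, ∑' z, q y * P n (z - y) * Real.cos (phase d k z) := hF.tsum_comm
      _ = ∑' y, q y * Real.cos (phase d k y) * (∑' w, P n w * Real.cos (phase d k w)) := by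
          refine tsum_congr fun y => ?_
          rw [← (Equiv.addRight y).tsum_eq (fun z => q y * P n (z - y) * Real.cos (phase d k z))]
          simp only [Equiv.coe_addRight, add_sub_cancel_right, phase_add, Real.cos_add]
          have hs1 : Summable fun w => P n w * Real.cos (phase d k w) :=
            Summable.of_norm_bounded (hPsum n) fun w => by
              rw [Real.norm_eq_abs, abs_mul, abs_of_nonneg (hPnn n w)]
              exact mul_le_of_le_one_right (hPnn n w) (Real.abs_cos_le_one _)
          have hs2 : Summable fun w => P n w * Real.sin (phase d k w) :=
            Summable.of_norm_bounded (hPsum n) fun w => by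
              rw [Real.norm_eq_abs, abs_mul, abs_of_nonneg (hPnn n w)]
              exact mul_le_of_le_one_right (hPnn n w) (Real.abs_sin_le_one _)
          have h1 : ∀ w, q y * P n w * (Real.cos (phase d k w) * Real.cos (phase d k y)
              - Real.sin (phase d k w) * Real.sin (phase d k y))
              = q y * Real.cos (phase d k y) * (P n w * Real.cos (phase d k w))
                - q y * Real.sin (phase d k y) * (P n w * Real.sin (phase d k w)) := by
            intro w; ring
          simp_rw [h1]
          rw [Summable.tsum_sub (hs1.mul_left _) (hs2.mul_left _), tsum_mul_left, tsum_mul_left,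
            tsum_even_mul_sin_eq_zero (convPow_even hqev hP0 hPs n) k, mul_zero, sub_zero]
      _ = (∑' y, q y * Real.cos (phase d k y)) ^ (n + 1) := by
          rw [tsum_mul_right, ih, pow_succ, mul_comm]

/-- `|φ(k)| ≤ 1` for the cosine transform of a sub-probability `q`. -/
theorem abs_fourier_q_le_one (hq0 : ∀ y, 0 ≤ q y) (hqs : Summable q) (hq1 : ∑' y, q y ≤ 1)
    (k : Fin d → ℝ) : |∑' y, q y * Real.cos (phase d k y)| ≤ 1 := by
  have hs : Summable fun y => q y * Real.cos (phase d k y) :=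
    Summable.of_norm_bounded hqs fun y => by
      rw [Real.norm_eq_abs, abs_mul, abs_of_nonneg (hq0 y)]
      exact mul_le_of_le_one_right (hq0 y) (Real.abs_cos_le_one _)
  calc |∑' y, q y * Real.cos (phase d k y)| ≤ ∑' y, |q y * Real.cos (phase d k y)| := by
        have := norm_tsum_le_tsum_norm hs.norm
        simpa only [Real.norm_eq_abs] using this
    _ ≤ ∑' y, q y := by
        refine hs.abs.tsum_le_tsum (fun y => ?_) hqs
        rw [abs_mul, abs_of_nonneg (hq0 y)]
        exact mul_le_of_le_one_right (hq0 y) (Real.abs_cos_le_one _)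
    _ ≤ 1 := hq1

/-- **Geometric partial sums**: for `|φ| ≤ 1`, `φ < 1`: `∑_{n<N} φ^n ≤ 2 / (1 − φ)`. -/
theorem geom_partial_sum_le {φ : ℝ} (hφ : |φ| ≤ 1) (hφ1 : φ < 1) (N : ℕ) :
    ∑ n ∈ Finset.range N, φ ^ n ≤ 2 / (1 - φ) := by
  have hne : φ ≠ 1 := hφ1.ne
  rw [geom_sum_eq hne]
  have hpos : 0 < 1 - φ := by linarith
  rw [show (φ ^ N - 1) / (φ - 1) = (1 - φ ^ N) / (1 - φ) by
    rw [← neg_sub 1 (φ ^ N), ← neg_sub 1 φ, neg_div_neg_eq]]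
  apply div_le_div_of_nonneg_right _ hpos.le
  have : |φ ^ N| ≤ 1 := by rw [abs_pow]; exact pow_le_one₀ (abs_nonneg _) hφ
  linarith [neg_abs_le (φ ^ N)]

/-- The cosine transform `φ` of a summable `q` is continuous. -/
theorem continuous_fourier_q (hqs : Summable q) :
    Continuous fun k : Fin d → ℝ => ∑' y, q y * Real.cos (phase d k y) := by
  refine continuous_tsum (fun y => ?_) hqs.abs (fun y k => ?_)
  · have := continuous_phase (d := d) y; fun_prop
  · rw [Real.norm_eq_abs, abs_mul]
    exact mul_le_of_le_one_right (abs_nonneg _) (Real.abs_cos_le_one _)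

end Fourier

end Summit.CriticalPhenomena.Ising3DConformalLimit.Theorems.EtaBoundsTransfer

namespace Summit.CriticalPhenomena.Ising3DConformalLimit.Theorems.EtaBoundsTransfer

open Finset Real MeasureTheory Filter Topology Literature.Probability.LatticeModels
open scoped BigOperators

section BlockSum

variable {d : ℕ} {q : Site d → ℝ} {P : ℕ → Site d → ℝ}

/-- Points of the cube have sup norm at most `π`. -/
theorem norm_le_pi_of_mem_cube {k : Fin d → ℝ}
    (hk : k ∈ Set.pi Set.univ (fun _ : Fin d => Set.Icc (-π) π)) : ‖k‖ ≤ π := by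
  refine (pi_norm_le_iff_of_nonneg Real.pi_pos.le).2 fun j => ?_
  rw [Real.norm_eq_abs, abs_le]
  exact hk j (Set.mem_univ j)

/-- Almost every point of `ℝ^d` (`d ≥ 1`) is nonzero. -/
theorem ae_ne_zero (hd : 1 ≤ d) : ∀ᵐ k ∂(volume : Measure (Fin d → ℝ)), k ≠ 0 := by
  haveI : Nonempty (Fin d) := ⟨⟨0, hd⟩⟩
  have h : (volume : Measure (Fin d → ℝ)) {0} = 0 := measure_singleton 0
  rw [ae_iff]
  simp only [ne_eq, not_not, Set.setOf_eq_eq_singleton]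
  exact h

/-- **Block sums of the Green series are controlled by a Brillouin-zone integral.**
For an even sub-probability step law `q` whose symbol satisfies `1 − φ(k) ≥ c₁‖k‖^α` on the cube,
the block sums of `∑_n P n` (the convolution powers of `q`) over a box satisfy
`∑_{y,y' ∈ Λ_m} ∑_n P n (y − y') ≤ (2/c₁)(2π)^{-d} ∫_{[-π,π]^d} ‖k‖^{-α} W_m(k) dk`,
`W_m(k) = ∑_{y,y' ∈ Λ_m} cos(k·(y − y'))` (Parseval for each power, geometric partial sums
`∑_{n<N} φ^n ≤ 2/(1−φ)`, monotone convergence in `N`). -/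
theorem block_sum_green_le (hd : 1 ≤ d) {c₁ α : ℝ}
    (hq0 : ∀ y, 0 ≤ q y) (hqs : Summable q) (hq1 : ∑' y, q y ≤ 1) (hqev : ∀ y, q (-y) = q y)
    (hP0 : ∀ z, P 0 z = if z = 0 then 1 else 0)
    (hPs : ∀ n z, P (n + 1) z = ∑' y, q y * P n (z - y))
    (hPnn : ∀ n z, 0 ≤ P n z) (hPsum : ∀ n, Summable (P n)) (hPn : ∀ z, Summable fun n => P n z)
    (hc₁ : 0 < c₁)
    (hlow : ∀ k : Fin d → ℝ, ‖k‖ ≤ π → k ≠ 0 →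
      c₁ * ‖k‖ ^ α ≤ 1 - ∑' y, q y * Real.cos (phase d k y))
    (m : ℕ)
    (hI : IntegrableOn (fun k : Fin d → ℝ => ‖k‖ ^ (-α) *
        ∑ y ∈ box d m, ∑ y' ∈ box d m, Real.cos (phase d k (y - y')))
      (Set.pi Set.univ (fun _ : Fin d => Set.Icc (-π) π))) :
    ∑ y ∈ box d m, ∑ y' ∈ box d m, ∑' n, P n (y - y')
      ≤ 2 / c₁ / (2 * π) ^ d * ∫ k in Set.pi Set.univ (fun _ : Fin d => Set.Icc (-π) π),
          ‖k‖ ^ (-α) * ∑ y ∈ box d m, ∑ y' ∈ box d m, Real.cos (phase d k (y - y')) := by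
  set K := Set.pi Set.univ (fun _ : Fin d => Set.Icc (-π) π) with hK
  set W : (Fin d → ℝ) → ℝ := fun k => ∑ y ∈ box d m, ∑ y' ∈ box d m, Real.cos (phase d k (y - y'))
    with hW
  set φ : (Fin d → ℝ) → ℝ := fun k => ∑' y, q y * Real.cos (phase d k y) with hφ
  set I : ℝ := ∫ k in K, ‖k‖ ^ (-α) * W k with hIdef
  have hπ := Real.pi_pos
  have h2π : (0 : ℝ) < (2 * π) ^ d := by positivity
  have hWnn : ∀ k, 0 ≤ W k := fun k => sum_box_box_cos_phase_sub_nonneg m k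
  have hWcont : Continuous W := by
    simp only [hW]
    refine continuous_finsetSum _ fun y _ => continuous_finsetSum _ fun y' _ => ?_
    have := continuous_phase (d := d) (y - y'); fun_prop
  have hφcont : Continuous φ := continuous_fourier_q hqs
  have hφabs : ∀ k, |φ k| ≤ 1 := fun k => abs_fourier_q_le_one hq0 hqs hq1 k
  -- Parseval for each power
  have hpars : ∀ n, (2 * π) ^ d * ∑ y ∈ box d m, ∑ y' ∈ box d m, P n (y - y')
      = ∫ k in K, φ k ^ n * W k := by
    intro n
    rw [← parseval_block (hPsum n) (box d m)]
    refine integral_congr_ae (Filter.Eventually.of_forall fun k => ?_)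
    simp only [hφ, hW]
    rw [fourier_convPow hq0 hqs hqev hP0 hPs hPnn hPsum k n]
  -- partial sums
  have hint : ∀ n, Integrable (fun k => φ k ^ n * W k) (volume.restrict K) := fun n =>
    integrableOn_cube_of_continuous ((hφcont.pow n).mul hWcont)
  have hpartial : ∀ N, ∑ n ∈ Finset.range N, ∑ y ∈ box d m, ∑ y' ∈ box d m, P n (y - y')
      ≤ 2 / c₁ / (2 * π) ^ d * I := by
    intro N
    have h1 : (2 * π) ^ d * ∑ n ∈ Finset.range N, ∑ y ∈ box d m, ∑ y' ∈ box d m, P n (y - y')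
        = ∫ k in K, (∑ n ∈ Finset.range N, φ k ^ n) * W k := by
      rw [Finset.mul_sum]
      simp_rw [hpars, Finset.sum_mul]
      rw [integral_finsetSum _ (fun n _ => hint n)]
    have h2 : ∫ k in K, (∑ n ∈ Finset.range N, φ k ^ n) * W k ≤ ∫ k in K, (2 / c₁) * (‖k‖ ^ (-α) * W k) := by
      refine integral_mono_ae ?_ (hI.const_mul _) ?_
      · have : (fun k => (∑ n ∈ Finset.range N, φ k ^ n) * W k) = fun k => ∑ n ∈ Finset.range N, φ k ^ n * W k := by
          funext k; rw [Finset.sum_mul]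
        rw [this]
        exact integrable_finsetSum _ (fun n _ => hint n)
      · rw [Filter.EventuallyLE, ae_restrict_iff' (MeasurableSet.univ_pi fun _ => measurableSet_Icc)]
        filter_upwards [ae_ne_zero hd] with k hk0 hkK
        have hnk : 0 < ‖k‖ := norm_pos_iff.2 hk0
        have hkπ : ‖k‖ ≤ π := norm_le_pi_of_mem_cube hkK
        have hlowk := hlow k hkπ hk0
        have hpos : 0 < c₁ * ‖k‖ ^ α := by positivity
        have hφ1 : φ k < 1 := by simp only [hφ]; linarith
        have hg := geom_partial_sum_le (hφabs k) hφ1 N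
        have h3 : 2 / (1 - φ k) ≤ 2 / c₁ * ‖k‖ ^ (-α) := by
          rw [Real.rpow_neg hnk.le, ← div_eq_mul_inv, div_div]
          exact div_le_div_of_nonneg_left (by norm_num) hpos hlowk
        calc (∑ n ∈ Finset.range N, φ k ^ n) * W k ≤ (2 / (1 - φ k)) * W k :=
              mul_le_mul_of_nonneg_right hg (hWnn k)
          _ ≤ (2 / c₁ * ‖k‖ ^ (-α)) * W k := mul_le_mul_of_nonneg_right h3 (hWnn k)
          _ = 2 / c₁ * (‖k‖ ^ (-α) * W k) := by ring
    rw [integral_const_mul] at h2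
    have h3 : ∑ n ∈ Finset.range N, ∑ y ∈ box d m, ∑ y' ∈ box d m, P n (y - y')
        = ((2 * π) ^ d)⁻¹ * ∫ k in K, (∑ n ∈ Finset.range N, φ k ^ n) * W k := by
      rw [← h1]; field_simp
    rw [h3]
    calc ((2 * π) ^ d)⁻¹ * ∫ k in K, (∑ n ∈ Finset.range N, φ k ^ n) * W k
        ≤ ((2 * π) ^ d)⁻¹ * (2 / c₁ * I) := mul_le_mul_of_nonneg_left h2 (by positivity)
      _ = 2 / c₁ / (2 * π) ^ d * I := by ring
  -- pass to the limit `N → ∞` and swap the sums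
  have hnn : ∀ n, 0 ≤ ∑ y ∈ box d m, ∑ y' ∈ box d m, P n (y - y') :=
    fun n => Finset.sum_nonneg fun y _ => Finset.sum_nonneg fun y' _ => hPnn n _
  have htsum := Real.tsum_le_of_sum_range_le hnn hpartial
  rw [Summable.tsum_finsetSum (fun y _ => summable_sum fun y' _ => hPn _)] at htsum
  simp_rw [Summable.tsum_finsetSum (fun y' _ => hPn _)] at htsum
  exact htsum

end BlockSum

end Summit.CriticalPhenomena.Ising3DConformalLimit.Theorems.EtaBoundsTransfer
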